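import Summits.NavierStokesRegularity.NavierStokesRegularity.Theorems.AdaptedFrequencyAdaptedFrequencyConvergesStubBlockSolverCaloric
import Summits.NavierStokesRegularity.NavierStokesRegularity.Theorems.AdaptedFrequencyAdaptedKernelExistsWeakCorrectorCalculus
import Literature.Analysis.FluidPDE.WholeSpaceIBP
import Literature.Analysis.FluidPDE.NewtonPotential
import Mathlib.MeasureTheory.Integral.IntervalIntegral.IntegrationByParts

/-!
# Crux `AdaptedFrequencyConverges` (stmt-NavierStokesRegularity-10493), line
  `cloud-frame-effective-tsai`: the caloric extension `F` against test functions, for STUB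
  `stub_blockSolver`

Helper file (lands `--supports stmt-NavierStokesRegularity-10493`).  With
`F(t, x) = e^{ν(T−t)Δ} f(x)` the backward caloric extension of smooth compactly supported data
(`…StubBlockSolverCaloric`: jointly smooth on `t < T`, `∂ₜF + νΔF = 0`) and a `C¹` drift `b` with
divergence-free slices, for every smooth `φ` compactly supported in `{t < T}`:

  `∫ F (∂ₜφ + b·∇φ − νΔφ) = −∫ (b·∇F) φ`   (`caloric_ibp`),

i.e. `F` is a very weak solution of `∂ₜF + b·∇F + νΔF = b·∇F`.  This is the pattern of the
tree's `weakCorrector_gamma_ibp` (file `…AdaptedKernelExistsWeakCorrectorGamma`, there for the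
backward heat KERNEL) verbatim: integration by parts in `t` line by line, the transport identity
and Green's second identity slice by slice, Fubini; the `∂ₜ` and `Δ` contributions cancel.
-/

noncomputable section

open MeasureTheory Set Filter Topology Metric Function intervalIntegral
open scoped ContDiff Laplacian InnerProductSpace
open Literature.Analysis.FluidPDE Literature.Analysis.UnboundedOperators
open Summit.NavierStokesRegularity.NavierStokesRegularity.Theorems.AdaptedKernelExists.NashEntropyLastBlock

namespace Summit.NavierStokesRegularity.NavierStokesRegularity.Theorems.AdaptedFrequencyConverges.CloudFrameEffectiveTsai

variable {ν T : ℝ} {f : EuclideanSpace ℝ (Fin 3) → ℝ} {F : ℝ → EuclideanSpace ℝ (Fin 3) → ℝ}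
  {b : ℝ → EuclideanSpace ℝ (Fin 3) → EuclideanSpace ℝ (Fin 3)}
  {φ : ℝ × EuclideanSpace ℝ (Fin 3) → ℝ}

/-! ### Slice identities for `F` -/

/-- Transport slice identity: `∫ F(t) (b(t)·∇φ(t)) dx = −∫ (b(t)·∇F(t)) φ(t) dx`. -/
theorem caloric_slice_transport (hf : ContDiff ℝ 1 f) (hfc : HasCompactSupport f)
    (hF : F = fun t x => heatExtension f (ν * (T - t)) x) {t : ℝ} (hb : ContDiff ℝ 1 (b t))
    (hdiv : VectorCalculus.IsDivFree (b t))
    (hφ : ContDiff ℝ 1 fun y : EuclideanSpace ℝ (Fin 3) => φ (t, y))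
    (hφc : HasCompactSupport fun y : EuclideanSpace ℝ (Fin 3) => φ (t, y)) :
    ∫ x, F t x * fderiv ℝ (fun y => φ (t, y)) x (b t x) =
      -∫ x, fderiv ℝ (F t) x (b t x) * φ (t, x) := by
  have hΓ : ContDiff ℝ 1 (F t) := caloric_contDiff_slice hf hfc hF t
  have h := integral_inner_convect_add_eq_zero hb hΓ hφ hφc
  have h0 : (fun x => VectorCalculus.divergence (b t) x *
      ⟪F t x, (fun y : EuclideanSpace ℝ (Fin 3) => φ (t, y)) x⟫_ℝ) = fun _ => 0 := by
    funext x; rw [hdiv x, zero_mul]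
  rw [h0, MeasureTheory.integral_zero, add_zero] at h
  simp only [convect_apply, RCLike.inner_apply, conj_trivial] at h
  have e1 : ∫ x, (fderiv ℝ (fun y => φ (t, y)) x) (b t x) * F t x =
      ∫ x, F t x * (fderiv ℝ (fun y => φ (t, y)) x) (b t x) :=
    integral_congr_ae (Eventually.of_forall fun x => mul_comm _ _)
  have e2 : ∫ x, φ (t, x) * (fderiv ℝ (F t) x) (b t x) =
      ∫ x, (fderiv ℝ (F t) x) (b t x) * φ (t, x) :=
    integral_congr_ae (Eventually.of_forall fun x => mul_comm _ _)
  linarith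

/-- Green slice identity: `∫ F(t) Δφ(t) dx = ∫ ΔF(t) φ(t) dx`. -/
theorem caloric_slice_laplacian (hf : ContDiff ℝ 2 f) (hfc : HasCompactSupport f)
    (hF : F = fun t x => heatExtension f (ν * (T - t)) x) {t : ℝ}
    (hφ : ContDiff ℝ 2 fun y : EuclideanSpace ℝ (Fin 3) => φ (t, y))
    (hφc : HasCompactSupport fun y : EuclideanSpace ℝ (Fin 3) => φ (t, y)) :
    ∫ x, F t x * (Δ (fun y => φ (t, y))) x = ∫ x, (Δ (F t)) x * φ (t, x) := by
  have h := integral_mul_laplacian_comm (f := F t) (g := fun y => φ (t, y))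
    (caloric_contDiff_slice hf hfc hF t) hφ hφc
  calc ∫ x, F t x * (Δ (fun y => φ (t, y))) x
      = ∫ x, (Δ (fun y => φ (t, y))) x * F t x :=
        integral_congr_ae (Eventually.of_forall fun x => mul_comm _ _)
    _ = ∫ x, φ (t, x) * (Δ (F t)) x := h.symm
    _ = ∫ x, (Δ (F t)) x * φ (t, x) :=
        integral_congr_ae (Eventually.of_forall fun x => mul_comm _ _)

/-- Integration by parts along a time line: for `a < c < T` and a `C¹` function `φ` whose
support has time projection inside `(a, c)`,
`∫ F(t, x) ∂ₜφ(t, x) dt = ν ∫ ΔF(t, x) φ(t, x) dt` (`∂ₜF = −νΔF` on `t < T`). -/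
theorem caloric_line_ibp (hν : 0 < ν) (hf : ContDiff ℝ 2 f) (hfc : HasCompactSupport f)
    (hF : F = fun t x => heatExtension f (ν * (T - t)) x) {a c : ℝ} (hac : a < c) (hcT : c < T)
    (hφ : ContDiff ℝ 1 φ) (hsupp : ∀ p ∈ tsupport φ, p.1 ∈ Ioo a c)
    (x : EuclideanSpace ℝ (Fin 3)) :
    ∫ t, F t x * deriv (fun s => φ (s, x)) t = ∫ t, ν * (Δ (F t)) x * φ (t, x) := by
  have hs1 : support (fun t => F t x * deriv (fun s => φ (s, x)) t) ⊆ Ioc a c := by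
    intro t ht
    have h' : deriv (fun s => φ (s, x)) t ≠ 0 := fun h0 => ht (by simp only [h0, mul_zero])
    have hmem : (t, x) ∈ tsupport φ :=
      by_contra fun hn => h' (weakCorrector_deriv_slice_eq_zero hφ (p := (t, x)) hn)
    exact Ioo_subset_Ioc_self (hsupp _ hmem)
  have hs2 : support (fun t => ν * (Δ (F t)) x * φ (t, x)) ⊆ Ioc a c := by
    intro t ht
    have h' : φ (t, x) ≠ 0 := fun h0 => ht (by simp only [h0, mul_zero])
    exact Ioo_subset_Ioc_self (hsupp _ (subset_tsupport _ h'))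
  rw [← intervalIntegral.integral_eq_integral_of_support_subset hs1,
    ← intervalIntegral.integral_eq_integral_of_support_subset hs2]
  have hu : ∀ t ∈ uIcc a c, HasDerivAt (fun s => F s x) (-(ν * (Δ (F t)) x)) t := by
    intro t ht
    rw [uIcc_of_le hac.le] at ht
    exact caloric_hasDerivAt_time hν hf hfc hF (ht.2.trans_lt hcT) x
  have hv : ∀ t ∈ uIcc a c, HasDerivAt (fun s => φ (s, x)) (deriv (fun s => φ (s, x)) t) t :=
    fun t _ => ((weakCorrector_contDiff_slice_t hφ x).differentiable one_ne_zero t).hasDerivAt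
  have hF2 : ContDiffOn ℝ 2 (uncurry F) (Iio T ×ˢ univ) :=
    (caloric_isSmoothSpaceTimeOn hν hf.continuous hfc hF).of_le (by norm_cast)
  have hL := lowerOfUpper_continuousOn_laplacian_slice isOpen_Iio hF2
  have hm : MapsTo (fun t : ℝ => ((t, x) : ℝ × EuclideanSpace ℝ (Fin 3))) (Iio T)
      (Iio T ×ˢ univ) :=
    fun t ht => mk_mem_prod ht (mem_univ x)
  have hpc : Continuous (fun t : ℝ => ((t, x) : ℝ × EuclideanSpace ℝ (Fin 3))) :=
      continuous_id.prodMk continuous_const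
  have hLx : ContinuousOn (fun t : ℝ => (Δ (F t)) x) (Iio T) := (hL.comp hpc.continuousOn hm :)
  have hIcc : Icc a c ⊆ Iio T := fun t ht => ht.2.trans_lt hcT
  have hu' : IntervalIntegrable (fun t => -(ν * (Δ (F t)) x)) volume a c :=
    ((continuousOn_const.mul hLx).neg.mono hIcc).intervalIntegrable_of_Icc hac.le
  have hv' : IntervalIntegrable (fun t => deriv (fun s => φ (s, x)) t) volume a c :=
    ((weakCorrector_continuous_deriv_slice hφ).comp
      (continuous_id.prodMk continuous_const)).intervalIntegrable _ _
  rw [intervalIntegral.integral_mul_deriv_eq_deriv_mul hu hv hu' hv']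
  have hφc0 : φ (c, x) = 0 :=
    by_contra fun h => (lt_irrefl c) (hsupp _ (subset_tsupport _ h)).2
  have hφa0 : φ (a, x) = 0 :=
    by_contra fun h => (lt_irrefl a) (hsupp _ (subset_tsupport _ h)).1
  rw [hφc0, hφa0, mul_zero, mul_zero, sub_zero, zero_sub, ← intervalIntegral.integral_neg]
  exact intervalIntegral.integral_congr fun t _ => by ring

/-! ### `F` against test functions -/

/-- **`F` against test functions** (very weak form of `∂ₜF + b·∇F + νΔF = b·∇F`): for a `C¹`
drift with divergence-free slices and a smooth `φ` compactly supported in `{t < T}`,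
`∫ F (∂ₜφ + b·∇φ − νΔφ) = −∫ (b·∇F) φ`. -/
theorem caloric_ibp (hν : 0 < ν) (hf : ContDiff ℝ 2 f) (hfc : HasCompactSupport f)
    (hF : F = fun t x => heatExtension f (ν * (T - t)) x) (hb : ContDiff ℝ 1 (uncurry b))
    (hdiv : ∀ t, VectorCalculus.IsDivFree (b t)) (hφ : ContDiff ℝ ∞ φ) (hφc : HasCompactSupport φ)
    (hφT : tsupport φ ⊆ Iio T ×ˢ univ) :
    ∫ p : ℝ × EuclideanSpace ℝ (Fin 3), F p.1 p.2 * (deriv (fun s => φ (s, p.2)) p.1 +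
        fderiv ℝ (fun y => φ (p.1, y)) p.2 (b p.1 p.2) - ν * (Δ (fun y => φ (p.1, y))) p.2) =
      -∫ p : ℝ × EuclideanSpace ℝ (Fin 3), fderiv ℝ (F p.1) p.2 (b p.1 p.2) * φ p := by
  set U : Set (ℝ × EuclideanSpace ℝ (Fin 3)) := Iio T ×ˢ univ with hU
  have hUo : IsOpen U := isOpen_Iio.prod isOpen_univ
  have hΓc : ContDiffOn ℝ 2 (uncurry F) U :=
    (caloric_isSmoothSpaceTimeOn hν hf.continuous hfc hF).of_le (by norm_cast)
  have cΓ : ContinuousOn (fun p : ℝ × EuclideanSpace ℝ (Fin 3) => F p.1 p.2) U := hΓc.continuousOn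
  have cD : ContinuousOn (fun p : ℝ × EuclideanSpace ℝ (Fin 3) => fderiv ℝ (F p.1) p.2) U :=
    lowerOfUpper_continuousOn_fderiv_slice isOpen_Iio hΓc
  have cL : ContinuousOn (fun p : ℝ × EuclideanSpace ℝ (Fin 3) => (Δ (F p.1)) p.2) U :=
    lowerOfUpper_continuousOn_laplacian_slice isOpen_Iio hΓc
  have hφ1 := weakCorrector_contDiff_one_of_infty hφ
  have hφ2 := weakCorrector_contDiff_two_of_infty hφ
  have hbc : Continuous (uncurry b) := hb.continuous
  -- the slice fields of `φ`
  obtain ⟨A, hA⟩ : ∃ A : ℝ × EuclideanSpace ℝ (Fin 3) → ℝ,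
      A = fun p => deriv (fun s => φ (s, p.2)) p.1 := ⟨_, rfl⟩
  obtain ⟨Bf, hBf⟩ : ∃ Bf : ℝ × EuclideanSpace ℝ (Fin 3) → ℝ,
      Bf = fun p => fderiv ℝ (fun y => φ (p.1, y)) p.2 (b p.1 p.2) := ⟨_, rfl⟩
  obtain ⟨L, hL⟩ : ∃ L : ℝ × EuclideanSpace ℝ (Fin 3) → ℝ,
      L = fun p => (Δ (fun y => φ (p.1, y))) p.2 := ⟨_, rfl⟩
  have cA : Continuous A := hA ▸ weakCorrector_continuous_deriv_slice hφ1
  have cB : Continuous Bf := hBf ▸ weakCorrector_continuous_fderiv_slice hφ1 hbc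
  have cLφ : Continuous L := hL ▸ weakCorrector_continuous_laplacian_slice hφ
  have zA : ∀ p, p ∉ tsupport φ → A p = 0 := fun p hp => by
    rw [hA]; exact weakCorrector_deriv_slice_eq_zero hφ1 hp
  have zB : ∀ p, p ∉ tsupport φ → Bf p = 0 := fun p hp => by
    rw [hBf]; exact weakCorrector_fderiv_slice_eq_zero hφ1 hp _
  have zL : ∀ p, p ∉ tsupport φ → L p = 0 := fun p hp => by
    rw [hL]; exact weakCorrector_laplacian_slice_eq_zero hφ2 hp
  have zφ : ∀ p, p ∉ tsupport φ → φ p = 0 := fun p hp => image_eq_zero_of_notMem_tsupport hp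
  -- integrability: continuous (gluing) with compact support
  have hint : ∀ {g k : ℝ × EuclideanSpace ℝ (Fin 3) → ℝ}, ContinuousOn g U → Continuous k →
      (∀ p, p ∉ tsupport φ → k p = 0) → Integrable (fun p => g p * k p) :=
    fun hg hk hk0 => weakCorrector_integrable_mul_of_tsupport hUo hg hk hφc hφT hk0
  have iA := hint cΓ cA zA
  have iB := hint cΓ cB zB
  have iL := hint cΓ cLφ zL
  have iF := hint (cD.clm_apply hbc.continuousOn) hφ.continuous zφ
  have cνL : ContinuousOn (fun p : ℝ × EuclideanSpace ℝ (Fin 3) => ν * (Δ (F p.1)) p.2) U :=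
    continuousOn_const.mul cL
  have iLΓ := hint cνL hφ.continuous zφ
  have iLΓ' := hint cL hφ.continuous zφ
  -- (B1) the time term
  have h1 : ∫ p : ℝ × EuclideanSpace ℝ (Fin 3), F p.1 p.2 * A p =
      ∫ p : ℝ × EuclideanSpace ℝ (Fin 3), ν * (Δ (F p.1)) p.2 * φ p := by
    obtain ⟨a, c, hac, hcT, hsupp⟩ := weakCorrector_time_bounds hφc hφT
    have e1 : ∫ p : ℝ × EuclideanSpace ℝ (Fin 3), F p.1 p.2 * A p =
        ∫ x, ∫ t, F t x * A (t, x) := integral_prod_symm _ iA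
    have e2 : ∫ p : ℝ × EuclideanSpace ℝ (Fin 3), ν * (Δ (F p.1)) p.2 * φ p =
        ∫ x, ∫ t, ν * (Δ (F t)) x * φ (t, x) := integral_prod_symm _ iLΓ
    rw [e1, e2]
    refine integral_congr_ae (Eventually.of_forall fun x => ?_)
    simp only [hA]
    exact caloric_line_ibp hν hf hfc hF hac hcT hφ1 hsupp x
  -- (B2) the transport term
  have h2 : ∫ p : ℝ × EuclideanSpace ℝ (Fin 3), F p.1 p.2 * Bf p =
      -∫ p : ℝ × EuclideanSpace ℝ (Fin 3), fderiv ℝ (F p.1) p.2 (b p.1 p.2) * φ p := by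
    have e1 : ∫ p : ℝ × EuclideanSpace ℝ (Fin 3), F p.1 p.2 * Bf p =
        ∫ t, ∫ x, F t x * Bf (t, x) := integral_prod _ iB
    have e2 : ∫ p : ℝ × EuclideanSpace ℝ (Fin 3), fderiv ℝ (F p.1) p.2 (b p.1 p.2) * φ p =
        ∫ t, ∫ x, fderiv ℝ (F t) x (b t x) * φ (t, x) := integral_prod _ iF
    rw [e1, e2, ← MeasureTheory.integral_neg]
    refine integral_congr_ae (Eventually.of_forall fun t => ?_)
    simp only [hBf]
    exact caloric_slice_transport (hf.of_le one_le_two) hfc hF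
      (hb.comp (contDiff_const.prodMk contDiff_id)) (hdiv t)
      (weakCorrector_contDiff_slice_x hφ1 t) (weakCorrector_hasCompactSupport_slice hφc t)
  -- (B3) the viscous term
  have h3 : ∫ p : ℝ × EuclideanSpace ℝ (Fin 3), F p.1 p.2 * L p =
      ∫ p : ℝ × EuclideanSpace ℝ (Fin 3), (Δ (F p.1)) p.2 * φ p := by
    have e1 : ∫ p : ℝ × EuclideanSpace ℝ (Fin 3), F p.1 p.2 * L p =
        ∫ t, ∫ x, F t x * L (t, x) := integral_prod _ iL
    have e2 : ∫ p : ℝ × EuclideanSpace ℝ (Fin 3), (Δ (F p.1)) p.2 * φ p =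
        ∫ t, ∫ x, (Δ (F t)) x * φ (t, x) := integral_prod _ iLΓ'
    rw [e1, e2]
    refine integral_congr_ae (Eventually.of_forall fun t => ?_)
    simp only [hL]
    exact caloric_slice_laplacian hf hfc hF (weakCorrector_contDiff_slice_x hφ2 t)
      (weakCorrector_hasCompactSupport_slice hφc t)
  -- assemble
  have hdec : ∀ p : ℝ × EuclideanSpace ℝ (Fin 3), F p.1 p.2 * (deriv (fun s => φ (s, p.2)) p.1 +
      fderiv ℝ (fun y => φ (p.1, y)) p.2 (b p.1 p.2) - ν * (Δ (fun y => φ (p.1, y))) p.2) =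
      F p.1 p.2 * A p + F p.1 p.2 * Bf p - ν * (F p.1 p.2 * L p) := by
    intro p; rw [hA, hBf, hL]; ring
  simp_rw [hdec]
  have i12 : Integrable (fun p : ℝ × EuclideanSpace ℝ (Fin 3) => F p.1 p.2 * A p +
      F p.1 p.2 * Bf p) := iA.add iB
  have i3 : Integrable (fun p : ℝ × EuclideanSpace ℝ (Fin 3) => ν * (F p.1 p.2 * L p)) :=
    iL.const_mul ν
  have h1' : ∫ p : ℝ × EuclideanSpace ℝ (Fin 3), ν * (Δ (F p.1)) p.2 * φ p =
      ν * ∫ p : ℝ × EuclideanSpace ℝ (Fin 3), (Δ (F p.1)) p.2 * φ p := by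
    rw [← MeasureTheory.integral_const_mul]
    exact integral_congr_ae (Eventually.of_forall fun p => mul_assoc _ _ _)
  rw [integral_sub i12 i3, integral_add iA iB, MeasureTheory.integral_const_mul, h1, h1', h2, h3]
  ring

/-! ### Registered sub-goal -/

/-- **Registered sub-goal `stub_blockSolver_source`** (closed form of `caloric_ibp`, sub-goal of
STUB `stub_blockSolver`): the backward caloric extension `F(t) = e^{ν(T−t)Δ}f` against test
functions supported in `{t < T}`: `∫ F (∂ₜφ + b·∇φ − νΔφ) = −∫ (b·∇F) φ`. -/
theorem stub_blockSolver_source :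
    ∀ (ν T : ℝ) (f : (EuclideanSpace ℝ (Fin 3)) → ℝ) (b : ℝ → (EuclideanSpace ℝ (Fin 3)) → (EuclideanSpace ℝ (Fin 3))) (φ : ℝ × (EuclideanSpace ℝ (Fin 3)) → ℝ), 0 < ν → ContDiff ℝ 2 f → HasCompactSupport f → ContDiff ℝ 1 (uncurry b) → (∀ t, VectorCalculus.IsDivFree (b t)) → ContDiff ℝ (⊤ : ℕ∞) φ → HasCompactSupport φ → tsupport φ ⊆ Iio T ×ˢ univ → ∫ p : ℝ × (EuclideanSpace ℝ (Fin 3)), Literature.Analysis.UnboundedOperators.heatExtension f (ν * (T - p.1)) p.2 * (deriv (fun s => φ (s, p.2)) p.1 + fderiv ℝ (fun y => φ (p.1, y)) p.2 (b p.1 p.2) - ν * Laplacian.laplacian (fun y => φ (p.1, y)) p.2) = -∫ p : ℝ × (EuclideanSpace ℝ (Fin 3)), fderiv ℝ (fun x => Literature.Analysis.UnboundedOperators.heatExtension f (ν * (T - p.1)) x) p.2 (b p.1 p.2) * φ p :=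
  fun _ _ _ _ _ hν hf hfc hb hdiv hφ hφc hφT => caloric_ibp hν hf hfc rfl hb hdiv hφ hφc hφT

end Summit.NavierStokesRegularity.NavierStokesRegularity.Theorems.AdaptedFrequencyConverges.CloudFrameEffectiveTsai

end
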